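import Literature.AlgebraicGeometry.HodgeTheory.WeilClassesFieldOneClass
import Literature.AlgebraicGeometry.Deligne1982.WeilTypeCMHodgeRing
import Summits.HodgeConjecture.HodgeConjecture.Theorems.Ring2HypothesesWeilComponentsCM
import HarnessLib

/-!
# Venture HSemireg — MARKMAN'S CLASS STATEMENT for a GENERAL CM FIELD `K` (`[K:ℚ] = e ≥ 2`), as printed: «`K` acts on
# `H^*(A,ℚ)` via algebraic correspondences and `HW(A,η′)` is 1-dimensional over `K`. Hence every class in `HW(A,η′)` is
# algebraic» — the ONE-CLASS LEMMA for the Weil space of a field `F ⊂ End⁰(A)` of any degree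

HONEST FRAMING. Lean index of the computation cell `pub-hsemireg` (seat p5, «Lean typer for the AMPLIFICATION CHAIN:
Markman's class statement AS PRINTED, with its hypotheses»). Nothing about any explicit variety is asserted; everything
below is PROVED from tree theorems (0 `sorry`, 0 definitions, 0 new named facts). Nothing here says that HC, HC_CM or
HC_AV is proved. No census row of the cell concerns a CM field of degree `> 2`; this file types the class-level sentence
of Markman's strategy in the generality in which it is PRINTED ([Mar25b] §4 opens «Let `K` be a CM-field»), closing the
`TODO(general form)` of `MarkmanClassStatement.lean` (module docstring, item (iv)).

The printed passage ([Mar25b] = E. Markman, *Secant sheaves and Weil classes on abelian varieties*, arXiv:2509.23403, §4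
«A strategy for proving the algebraicity of Weil classes», pp. 9–10 — the passage quoted next is on PDF p. 10, lines 6–10 of the
arXiv v2 text layer; §4 opens on p. 9; `K` a CM field, `e = [K:ℚ]`, `d = dim_K H¹(A,ℚ)`,
`HW(A,η) = ∧^d_K H¹(A,ℚ)`): «[…] It follows that `γ := κ_{d/2}(E) − δ` is a non-zero class in `HW(X×X̂,η)`, for some
`δ ∈ Im[Sym^{d/2}(𝒜²)]`, by Condition (2c). The class `γ` remains algebraic on every `(A,η′,h′)` deformation equivalent
to `(X×X̂,η,h)`, since `κ_{d/2}(E)` and `δ` do. Now `K` acts on `H^*(A,ℚ)` via algebraic correspondences and `HW(A,η′)`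
is 1-dimensional over `K`. Hence every class in `HW(A,η′)` is algebraic.»

Tree vocabulary: `F = ℚ(φ) ≅ ℚ[T]/(P)` for ONE `φ : A ⟶ A` with `P(φ) = 0`, `P ∈ ℤ[T]` irreducible over `ℚ` of degree
`e`, `e · r = 2 dim A`; `HW ⊗ ℂ = weilClassesField A φ P r` (Moonen–Zarhin §1: `W_F ⊗ ℂ = ⊕_σ ⋀ʳ V_{ℂ,σ}`); a CM field
`K = ℚ(η) ≅ ℚ[T]/(R(T²))` of degree `2e₀` with `d = 2k` is Deligne's datum `IsWeilTypeCM A η R e₀ k`.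
* §1 = the Literature theorem-only file `HodgeTheory/WeilClassesFieldOneClass.lean` (this seat, same day): the
  **ONE-CLASS LEMMA** `HodgeTheory.weilClassesField_le_algebraicClasses_of_isRationalClass_of_ne_zero` — for a field
  `F = ℚ(φ)` of ANY degree, ONE non-zero RATIONAL algebraic `γ ∈ W_F ⊗ ℂ` (degree `r = 2m > 0`, `e · r = 2 dim A`) ⟹
  `W_F ⊗ ℂ ≤ algebraicClasses` — and `HodgeTheory.weilClassesField_le_algebraicClasses_of_kappa` (`κ`, `δ` rational
  algebraic, `κ − δ ∈ W ∖ 0`). (`e = 2`: the tree's `weilClassesOf_le_algebraicClasses_iff_exists_ne_zero_of_dim_eq`.)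
* §2 POINTWISE on Deligne's CM carriers: `weilClassesFieldCM_le_algebraicClasses_of_isRationalClass_of_ne_zero` /
  `…_of_kappa`, `rational_weilClassesCM_algebraic_of_seed` (the `(A,η)`-slice of `Ring2.Hypotheses.WeilClassesComponentCM`).
* §3 ON THE COMPONENT `(K, 2k, δ)`, modulo the two NAMED inputs of the only CM-field family currency in the tree
  (`Ring2HypothesesWeilComponentsCM`): for every member and every Weil class of it, a pointed Weil family reaching a member
  that carries a Markman seed (`PointedWeilFamiliesComponentCM … ⟨seed⟩`) ∧ the δ-Weil-confined variational Hodge statement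
  (`WeilVariationalHodgeComponentCM`, OPEN) ⟹ `WeilClassesComponentCM R e₀ k δ`
  (`weilClassesComponentCM_of_kappaPointed_of_variational`, `…_of_seedPointed_…`). Implications only.
* NOT typed: the transfer («the Semi-regularity theorem»: p4 / Literature; no CM-field reach or object door exists in the
  tree — `weilFamilyReach_similar`, `HasHyperbolicSeedOn` are imaginary-quadratic), `𝒜²` and Equation (1.1) for `e > 2`
  (`δ` enters only as «an algebraic class», which is all the printed argument uses of it).

References: [Markman2025SurveySecant] arXiv:2509.23403 §4 (pp. 9–10), §12 (p. 21 in both arXiv versions; the «p. 20» of this file's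
first version was the held corpus chunk number, not a PDF page) — a SURVEY, published: Proc. ICM 2026 Vol. 3 (SIAM,
2026) pp. 586–602, bib `Markman2026ICMSecant` (SIAM pagination/numbering not verified against the arXiv text quoted here); the
RESULTS it reports are proved in [Markman2025SecantWeil] arXiv:2502.03415, a PREPRINT; [MoonenZarhin1998WeilClasses] Crelle 496
(1998) §1; [Deligne1982HodgeCycles] LNM 900 §4 (4.4), p. 30, proof of Thm. 4.8; [Fulton1998] Cor. 19.2 (b);
[CharlesSchnell2014Notes] Conj. 11.3.1; [vanGeemen1994HodgeAV] 4.9, proof of Thm. 6.12 (`e = 2`).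
-/

noncomputable section

open CategoryTheory Polynomial Module

namespace Summit.Ventures.HSemireg

open Literature.AlgebraicGeometry Literature.AlgebraicGeometry.Motives
open Literature.AlgebraicGeometry.HodgeTheory
open Literature.AlgebraicGeometry.Deligne1982
open Literature.AlgebraicTopology.SingularHomology

/-! §1 (the ONE-CLASS LEMMA for any field `F`) lives in `Literature/AlgebraicGeometry/HodgeTheory/WeilClassesFieldOneClass.lean`. -/

/-! ## §2 Markman's class statement, pointwise, for a CM field of any degree -/

section Pointwise

variable {A : AbelianVariety ℂ}

variable {η : A ⟶ A} {R : Polynomial ℤ} {e₀ k : ℕ}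

/-- **The one-class lemma on Deligne's carriers for a CM field `K = ℚ(η) ≅ ℚ[T]/(R(T²))` of degree `2e₀`**
(`IsWeilTypeCM A η R e₀ k`: `η̄ = -η`, `d = dim_K H¹ = 2k`, `a_σ = b_σ = k`): ONE non-zero rational algebraic class in
`HW ⊗ ℂ = weilClassesField A η R(T²) (2k)` makes every Weil class algebraic; the hypotheses of §1 (`R(T²)` irreducible
of degree `2e₀`, `R(η²) = 0`, `2e₀ · 2k = 2 dim A`, `k ≥ 1`) are fields of the datum. [cite: Markman2025SurveySecant, §4 (pp. 9–10)]
[cite: Deligne1982HodgeCycles, §4 (4.4) and Prop. 4.4] [cite: MoonenZarhin1998WeilClasses, §1] -/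
theorem weilClassesFieldCM_le_algebraicClasses_of_isRationalClass_of_ne_zero
    (hW : IsWeilTypeCM A η R e₀ k) {γ : complexBetti A.X (2 * k)}
    (hγW : γ ∈ weilClassesField A η (R.comp (Polynomial.X ^ 2)) (2 * k)) (hγQ : IsRationalClass γ) (hγ0 : γ ≠ 0)
    (hγalg : γ ∈ algebraicClasses A.X k) :
    weilClassesField A η (R.comp (Polynomial.X ^ 2)) (2 * k) ≤ algebraicClasses A.X k :=
  weilClassesField_le_algebraicClasses_of_isRationalClass_of_ne_zero hW.natDegree_comp
    hW.irreducible hW.eval₂_eq_zero hW.degree_mul_rank hW.k_pos hγW hγQ hγ0 hγalg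

/-- **Markman's class statement, pointwise, on Deligne's carriers for a CM field of degree `2e₀`** ([Mar25b] §4 «Let `K`
be a CM-field»): for `(A, η)` of Weil type relative to `K`, rational algebraic `κ`, `δ` of degree `d = 2k` with `κ − δ`
a NON-ZERO class of `HW ⊗ ℂ` make every class of `HW ⊗ ℂ` algebraic. [cite: Markman2025SurveySecant, §4 (pp. 9–10)]
[cite: Markman2026ICMSecant, §4 of the arXiv text (published ICM 2026 survey reporting it; proof = Markman2025SecantWeil, preprint)]
[cite: Deligne1982HodgeCycles, §4 (4.4) and Prop. 4.4] -/
theorem weilClassesFieldCM_le_algebraicClasses_of_kappa (hW : IsWeilTypeCM A η R e₀ k)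
    {κ δ : complexBetti A.X (2 * k)} (hκQ : IsRationalClass κ) (hκ : κ ∈ algebraicClasses A.X k)
    (hδQ : IsRationalClass δ) (hδ : δ ∈ algebraicClasses A.X k)
    (hγW : κ - δ ∈ weilClassesField A η (R.comp (Polynomial.X ^ 2)) (2 * k)) (hγ0 : κ - δ ≠ 0) :
    weilClassesField A η (R.comp (Polynomial.X ^ 2)) (2 * k) ≤ algebraicClasses A.X k :=
  weilClassesField_le_algebraicClasses_of_kappa hW.natDegree_comp hW.irreducible
    hW.eval₂_eq_zero hW.degree_mul_rank hW.k_pos hκQ hκ hδQ hδ hγW hγ0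

/-- **The `(A, η)`-slice of the ring-2 class targets `Ring2.Hypotheses.WeilClassesWeilTypeCM` /
`WeilClassesComponentCM R e₀ k δ` from ONE seed**, in their literal conclusion shape (the Hodge-type and rationality
binders are idle: every class is algebraic). Nothing is claimed about the OTHER members of the component (§3).
[cite: Markman2025SurveySecant, §4 (pp. 9–10) and §12 (p. 21)] [cite: Deligne1982HodgeCycles, §4 Prop. 4.4] -/
theorem rational_weilClassesCM_algebraic_of_seed (hW : IsWeilTypeCM A η R e₀ k)
    {γ : complexBetti A.X (2 * k)} (hγW : γ ∈ weilClassesField A η (R.comp (Polynomial.X ^ 2)) (2 * k))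
    (hγQ : IsRationalClass γ) (hγ0 : γ ≠ 0) (hγalg : γ ∈ algebraicClasses A.X k) :
    ∀ c ∈ weilClassesField A η (R.comp (Polynomial.X ^ 2)) (2 * k), IsRationalClass c →
      IsOfHodgeType A.dim A.X (2 * k) k k c → c ∈ algebraicClasses A.X k :=
  fun _ hc _ _ => weilClassesFieldCM_le_algebraicClasses_of_isRationalClass_of_ne_zero hW hγW hγQ hγ0 hγalg hc

end Pointwise

/-! ## §3 On the component `(K, d, disc)`, modulo the two NAMED inputs of the ring-2 currency: a Weil family through a
SEEDED member («in the connected component of moduli containing `(X×X̂,η,h)`») and the δ-Weil-confined variational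
Hodge statement («remains algebraic on every polarized abelian variety of Weil type … deformation equivalent») -/

section Component

open Summit.HodgeConjecture.HodgeConjecture.Ring2.Hypotheses

variable {R : Polynomial ℤ} [Fact (Irreducible (realPolyQ R))] {e₀ k : ℕ} {δ : cmNormResidueGroup R}

/-- **Markman's class statement for a CM field ON THE COMPONENT `(K = ℚ[T]/(R(T²)), d = 2k, disc = δ)`, modulo named
inputs** ([Mar25b] §4: «`κ(E)` remains algebraic on every polarized abelian variety of Weil type `(A,η′,h′)` in the
connected component of moduli containing `(X×X̂,η,h)` … Hence every class in `HW(A,η′)` is algebraic»), in the ONLY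
family currency the tree has for CM fields of degree `> 2` (`Ring2HypothesesWeilComponentsCM`): IF for every member `A` of
the component and every non-zero rational `(k,k)` Weil class `c` of `A` a smooth projective `(K, 2k, δ)`-Weil family through `A`
carries `c` to a member CARRYING A MARKMAN SEED (the per-`(member, class)` supply schema of ring 2) — a seed being a Weil-type
datum `(A′, η′)` with RATIONAL ALGEBRAIC `κ`, `δ′` of degree `2k`, `κ − δ′` a non-zero class of `HW(A′) ⊗ ℂ` (in print
`κ = κ_{d/2}(E)`, `E` semiregular on `X×X̂`, `δ′ ∈ Im[Sym^{d/2}(𝒜²)]`) — (`PointedWeilFamiliesComponentCM … ⟨seed⟩`, BY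
NAME), and IF the δ-Weil-confined variational Hodge statement holds there (`WeilVariationalHodgeComponentCM`, BY NAME;
OPEN, Charles–Schnell Conj. 11.3.1; in print «the Semi-regularity theorem» applied to `E`), THEN
`WeilClassesComponentCM R e₀ k δ`. The seed anchor is VALID by §2 and `mem_algebraicClasses_map_iff_of_iso`; the
assembly is ring 2's `weilClassesComponentCM_of_pointed_of_variational`. An implication between typed statements;
NOTHING is in print for any component with `e₀ ≥ 2` ([Mar25b] §12). [cite: Markman2025SurveySecant, §4 (pp. 9–10) and §12 (p. 21)]
[cite: Markman2026ICMSecant, §4 and §12 of the arXiv text (published ICM 2026 survey; results preprint)]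
[cite: Deligne1982HodgeCycles, §4 proof of Thm. 4.8] [cite: CharlesSchnell2014Notes, Conj. 11.3.1] -/
theorem weilClassesComponentCM_of_kappaPointed_of_variational
    (hP : PointedWeilFamiliesComponentCM R e₀ k δ
      (fun X x => ∃ (A' : AbelianVariety ℂ) (η' : A' ⟶ A') (e' : A'.X ≅ X) (κ δ' : complexBetti A'.X (2 * k)),
        IsWeilTypeCM A' η' R e₀ k ∧
        complexBetti.map e'.hom (2 * k) x ∈ weilClassesField A' η' (R.comp (Polynomial.X ^ 2)) (2 * k) ∧
        IsRationalClass κ ∧ κ ∈ algebraicClasses A'.X k ∧ IsRationalClass δ' ∧ δ' ∈ algebraicClasses A'.X k ∧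
        κ - δ' ∈ weilClassesField A' η' (R.comp (Polynomial.X ^ 2)) (2 * k) ∧ κ - δ' ≠ 0))
    (hV : WeilVariationalHodgeComponentCM R e₀ k δ) :
    WeilClassesComponentCM R e₀ k δ := by
  refine weilClassesComponentCM_of_pointed_of_variational (fun X x hanch _ _ => ?_) hP hV
  obtain ⟨A', η', e', κ, δ', hW', hxW, hκQ, hκ, hδQ, hδ, hγW, hγ0⟩ := hanch
  exact (mem_algebraicClasses_map_iff_of_iso e').1
    (weilClassesFieldCM_le_algebraicClasses_of_kappa hW' hκQ hκ hδQ hδ hγW hγ0 hxW)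

/-- **The same with the seed recorded as ONE non-zero rational algebraic Weil class `γ`** (the form §1 consumes; `γ =
κ_{d/2}(E) − δ` in print). [cite: Markman2025SurveySecant, §4 (pp. 9–10) and §12 (p. 21)]
[cite: Deligne1982HodgeCycles, §4 proof of Thm. 4.8] [cite: CharlesSchnell2014Notes, Conj. 11.3.1] -/
theorem weilClassesComponentCM_of_seedPointed_of_variational
    (hP : PointedWeilFamiliesComponentCM R e₀ k δ
      (fun X x => ∃ (A' : AbelianVariety ℂ) (η' : A' ⟶ A') (e' : A'.X ≅ X) (γ : complexBetti A'.X (2 * k)),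
        IsWeilTypeCM A' η' R e₀ k ∧
        complexBetti.map e'.hom (2 * k) x ∈ weilClassesField A' η' (R.comp (Polynomial.X ^ 2)) (2 * k) ∧
        γ ∈ weilClassesField A' η' (R.comp (Polynomial.X ^ 2)) (2 * k) ∧ IsRationalClass γ ∧ γ ≠ 0 ∧
        γ ∈ algebraicClasses A'.X k))
    (hV : WeilVariationalHodgeComponentCM R e₀ k δ) :
    WeilClassesComponentCM R e₀ k δ := by
  refine weilClassesComponentCM_of_pointed_of_variational (fun X x hanch _ _ => ?_) hP hV
  obtain ⟨A', η', e', γ, hW', hxW, hγW, hγQ, hγ0, hγalg⟩ := hanch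
  exact (mem_algebraicClasses_map_iff_of_iso e').1
    (weilClassesFieldCM_le_algebraicClasses_of_isRationalClass_of_ne_zero hW' hγW hγQ hγ0 hγalg hxW)

end Component

end Summit.Ventures.HSemireg

end
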